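import Mathlib

/-!
# `GrenetZeon.DualUnipotentThreeHalves` (stmt-ValiantsHypothesis-24318) — P-Q1 kernel port (lead-g2 `Q1-PROOF.md`), Level 1 bricks:
# POWERS OF THE BORDERED SHIFT `A = J ⊕ 0`, AND KRYLOV TRIANGULARITY («`V⁻ ⊥ ℂ[J]V⁺` ⇒ `V⁻` lives to the right of the top support of `V⁺`»)

Experiment cell «val-heavytop-census» (D-0160), engine seat val-htc-eng-1 (g3), kit 0; director R340 (3) (P-Q1 port, eng lineage).  Conventions of
eng-2 g3's bricks (✓ `…HeavyTopBorderOrthogonality`, `…HeavyTopTorusInitial`, `…HeavyTopPencilFirstOrder`) and of ✓ `…HeavyTopBorderPathCount`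
(this seat): ambient `Matrix (Fin (s+1)) (Fin (s+1)) ℂ`, border `∞ = Fin.last s`, the shift taken abstractly through its entries
`hA : A i j = if j = i+1 ∧ j < s then 1 else 0` (`A e_{i+1} = e_i` on the block, `A e_0 = A e_∞ = 0`).

* `shift_pow_succ_apply` — `(A^{a+1})_{ij} = [j = i + a + 1 ∧ j < s]`; `shift_pow_succ_mulVec` — `(A^{a+1} u)_j = u_{j+a+1}` (`j + a + 1 < s`), else `0`.
* ★ `lower_eq_zero_of_dotProduct_shift_pow` — KRYLOV TRIANGULARITY: if `u` is supported on rows `< t` with `u_{t−1} ≠ 0` and `w ⬝ᵥ (A^k u) = 0`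
  for all `k` (= the conclusion of ✓ `border_dotProduct_pow_mulVec_eq_zero`, Q1-PROOF (L1.a) «`wᵀ J^k u = 0`»), then `w_j = 0` for all `j < t`
  (strong induction on `j`: the equation for `k = t−1−j` reads `w_j u_{t−1} + (terms with w_{j'}, j' < j) = 0`).  This is the lead's
  «`ℂ[J]V⁺ = ⟨e_1,…,e_t⟩`, so `V⁻ ⊂ ⟨E_{s,t+1},…,E_{s,s−1}⟩` and `dim V⁺ + dim V⁻ ≤ s−1`» (1-indexed there; here 0-indexed with `s ↦ s+1`);
  `le_of_ne_zero_of_dotProduct_shift_pow` — contrapositive form `w_j ≠ 0 ⇒ t ≤ j`.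

Pure matrix algebra; nothing here is a statement about nilpotent subspaces, ι(7), (5,7), R2 or 24318 (OPEN / not moved); VP ≠ VNP NOT proved.
`--supports stmt-ValiantsHypothesis-24318 --as helper`.  No definitions, no named facts.
[lead-g2 `Q1-PROOF.md` §1 (L1.a)–(L1.b) = crux `CENSUS-Q1-PROOF.md`; eng-2 g3 INBOX 02:28:12Z; this seat]
-/

set_option linter.dupNamespace false
set_option autoImplicit false

namespace Summit.ValiantsHypothesis.ValiantsHypothesis.Theorems.GrenetZeon.HeavyTopBorderShift

open Matrix
open scoped BigOperators

variable {s : ℕ}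

/-! ## §1 Powers of the shift -/

/-- **Powers of the bordered shift**: if `A_{ij} = [j = i+1 ∧ j < s]` on `Fin (s+1)` (the shift `J` on the block `0..s−1`, zero border), then
`(A^{a+1})_{ij} = [j = i + a + 1 ∧ j < s]`. [folklore] -/
theorem shift_pow_succ_apply (A : Matrix (Fin (s + 1)) (Fin (s + 1)) ℂ)
    (hA : ∀ i j : Fin (s + 1), A i j = if (j : ℕ) = i + 1 ∧ (j : ℕ) < s then 1 else 0) :
    ∀ (a : ℕ) (i j : Fin (s + 1)), (A ^ (a + 1)) i j = if (j : ℕ) = i + (a + 1) ∧ (j : ℕ) < s then 1 else 0 := by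
  intro a
  induction a with
  | zero => intro i j; rw [zero_add, pow_one, hA]
  | succ a ih =>
    intro i j
    rw [pow_succ, Matrix.mul_apply]
    by_cases h : (j : ℕ) = i + (a + 1 + 1) ∧ (j : ℕ) < s
    · rw [if_pos h]
      have hc : (i : ℕ) + (a + 1) < s + 1 := by omega
      rw [Finset.sum_eq_single ⟨i + (a + 1), hc⟩]
      · rw [ih i ⟨_, hc⟩, hA ⟨_, hc⟩ j, if_pos (by simp; omega), if_pos (by simp; omega), mul_one]
      · intro c _ hc'
        have hne : (c : ℕ) ≠ i + (a + 1) := fun e => hc' (Fin.ext e)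
        rw [ih i c, if_neg (by omega), zero_mul]
      · intro h'
        exact absurd (Finset.mem_univ _) h'
    · rw [if_neg h]
      refine Finset.sum_eq_zero fun c _ => ?_
      rw [ih i c, hA c j]
      by_cases h1 : (c : ℕ) = i + (a + 1) ∧ (c : ℕ) < s
      · rw [if_pos h1, if_neg (by omega), mul_zero]
      · rw [if_neg h1, zero_mul]

/-- **The shift on vectors**: `(A^{a+1} u)_j = u_{j+a+1}` if `j + a + 1 < s`, else `0`. [folklore] -/
theorem shift_pow_succ_mulVec (A : Matrix (Fin (s + 1)) (Fin (s + 1)) ℂ)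
    (hA : ∀ i j : Fin (s + 1), A i j = if (j : ℕ) = i + 1 ∧ (j : ℕ) < s then 1 else 0) (u : Fin (s + 1) → ℂ) (a : ℕ)
    (j : Fin (s + 1)) :
    (A ^ (a + 1) *ᵥ u) j = if h : (j : ℕ) + (a + 1) < s then u ⟨(j : ℕ) + (a + 1), by omega⟩ else 0 := by
  rw [Matrix.mulVec, dotProduct]
  by_cases h : (j : ℕ) + (a + 1) < s
  · rw [dif_pos h, Finset.sum_eq_single ⟨(j : ℕ) + (a + 1), by omega⟩]
    · rw [shift_pow_succ_apply A hA a, if_pos (by simp; omega), one_mul]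
    · intro c _ hc
      have hne : (c : ℕ) ≠ j + (a + 1) := fun e => hc (Fin.ext e)
      rw [shift_pow_succ_apply A hA a, if_neg (by omega), zero_mul]
    · intro h'
      exact absurd (Finset.mem_univ _) h'
  · rw [dif_neg h]
    refine Finset.sum_eq_zero fun c _ => ?_
    rw [shift_pow_succ_apply A hA a, if_neg (by omega), zero_mul]

/-! ## §2 Krylov triangularity (the step after (L1.a) in Q1-PROOF §1) -/

/-- **Krylov triangularity.**  If `u` is supported on rows `< t`, `u_{t−1} ≠ 0`, and `w ⊥ A^k u` for every `k` (the conclusion of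
✓ `border_dotProduct_pow_mulVec_eq_zero`), then `w_j = 0` for every `j < t`: the vectors `u, Au, …, A^{t−1}u` are triangular with respect to
`e_{t−1}, …, e_0`, so `ℂ[J]u = ⟨e_0,…,e_{t−1}⟩` (Q1-PROOF (L1.a): «`V⁻ ⊂ ⟨E_{s,t+1},…,E_{s,s−1}⟩`», 0-indexed). [lead-g2 Q1-PROOF §1; this file] -/
theorem lower_eq_zero_of_dotProduct_shift_pow (A : Matrix (Fin (s + 1)) (Fin (s + 1)) ℂ)
    (hA : ∀ i j : Fin (s + 1), A i j = if (j : ℕ) = i + 1 ∧ (j : ℕ) < s then 1 else 0) {t : ℕ} (ht : 1 ≤ t) (hts : t ≤ s)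
    (u w : Fin (s + 1) → ℂ) (hu : ∀ i : Fin (s + 1), t ≤ (i : ℕ) → u i = 0) (hut : u ⟨t - 1, by omega⟩ ≠ 0)
    (horth : ∀ k : ℕ, w ⬝ᵥ (A ^ k *ᵥ u) = 0) : ∀ j : Fin (s + 1), (j : ℕ) < t → w j = 0 := by
  -- strong induction on the index
  suffices H : ∀ n : ℕ, ∀ j : Fin (s + 1), (j : ℕ) = n → n < t → w j = 0 from fun j hj => H j j rfl hj
  intro n
  induction n using Nat.strong_induction_on with
  | _ n ih =>
    intro j hjn hnt
    by_cases hk : n = t - 1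
    · -- use `w ⊥ u`
      have h0 := horth 0
      rw [pow_zero, Matrix.one_mulVec, dotProduct, Finset.sum_eq_single j] at h0
      · have hj' : j = ⟨t - 1, by omega⟩ := Fin.ext (by simp; omega)
        rw [hj'] at h0 ⊢
        exact (mul_eq_zero.1 h0).resolve_right hut
      · intro c _ hc
        have hne : (c : ℕ) ≠ n := fun e => hc (Fin.ext (by omega))
        by_cases hc' : (c : ℕ) < n
        · rw [ih c hc' c rfl (by omega), zero_mul]
        · rw [hu c (by omega), mul_zero]
      · intro h'
        exact absurd (Finset.mem_univ _) h'
    · -- use `w ⊥ A^{t-1-n} u` with `t - 1 - n ≥ 1`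
      obtain ⟨a, ha⟩ : ∃ a, t - 1 - n = a + 1 := ⟨t - 1 - n - 1, by omega⟩
      have h1 := horth (a + 1)
      rw [dotProduct, Finset.sum_eq_single j] at h1
      · rw [shift_pow_succ_mulVec A hA u a j, dif_pos (by omega)] at h1
        have hidx : (⟨(j : ℕ) + (a + 1), by omega⟩ : Fin (s + 1)) = ⟨t - 1, by omega⟩ := Fin.ext (by simp; omega)
        rw [hidx] at h1
        exact (mul_eq_zero.1 h1).resolve_right hut
      · intro c _ hc
        have hne : (c : ℕ) ≠ n := fun e => hc (Fin.ext (by omega))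
        rw [shift_pow_succ_mulVec A hA u a c]
        by_cases hc' : (c : ℕ) < n
        · rw [ih c hc' c rfl (by omega), zero_mul]
        · by_cases hcs : (c : ℕ) + (a + 1) < s
          · rw [dif_pos hcs, hu _ (by simp; omega), mul_zero]
          · rw [dif_neg hcs, mul_zero]
      · intro h'
        exact absurd (Finset.mem_univ _) h'

/-- **The border-shape bound of (L1.a)**, vector form: under the same hypotheses `w` is supported on the block columns `t, …, s−1`
together with whatever it has at `∞` — i.e. `w_j ≠ 0 ⇒ t ≤ j`. [this file] -/
theorem le_of_ne_zero_of_dotProduct_shift_pow (A : Matrix (Fin (s + 1)) (Fin (s + 1)) ℂ)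
    (hA : ∀ i j : Fin (s + 1), A i j = if (j : ℕ) = i + 1 ∧ (j : ℕ) < s then 1 else 0) {t : ℕ} (ht : 1 ≤ t) (hts : t ≤ s)
    (u w : Fin (s + 1) → ℂ) (hu : ∀ i : Fin (s + 1), t ≤ (i : ℕ) → u i = 0) (hut : u ⟨t - 1, by omega⟩ ≠ 0)
    (horth : ∀ k : ℕ, w ⬝ᵥ (A ^ k *ᵥ u) = 0) {j : Fin (s + 1)} (hj : w j ≠ 0) : t ≤ (j : ℕ) := by
  by_contra h
  exact hj (lower_eq_zero_of_dotProduct_shift_pow A hA ht hts u w hu hut horth j (by omega))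

end Summit.ValiantsHypothesis.ValiantsHypothesis.Theorems.GrenetZeon.HeavyTopBorderShift
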